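import Summits.ResolutionOfSingularities.ResolutionOfSingularities.Theorems.HilbertSamuelEliminationSigmaMaxModificationsCorridor3WLadderIsoTailsArcTranslatedGen
import Literature.AlgebraicGeometry.Resolution.BlowupAlgebraLift
import Mathlib.RingTheory.MvPowerSeries.NoZeroDivisors
import Mathlib.RingTheory.MvPowerSeries.Inverse
import Mathlib.RingTheory.LocalRing.RingHom.Basic
import Mathlib.RingTheory.Localization.AtPrime.Basic
import HarnessLib

/-!
# [OURS · L1 W4.2 · D14 ROUTE G v2 «ARC LIMIT» · G0 FRAME STACK AT GENERAL `d`, file 2] FORMAL FRAME PROPAGATION along one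
# free-rational chart step in `κ⟦t, y_1, …, y_d⟧`, and POINT MATCHING
# (crux `SigmaMaxModifications` stmt-ResolutionOfSingularities-18506 / conjunct stmt-…-19249; line `w_ladder` v8.3; kernel K1
# `IsoFreeRationalTailsImpossible` in EVERY embedding dimension; `--supports stmt-ResolutionOfSingularities-19249`, helper)

OURS (cell `res-hironaka`, slot ★L-G4 W4.2; hand res-type-071, object G0-L of res-L1-w42-lead-1's memo `ROUTE-G-ARCLIMIT.md` sha16
`96c77a196e17bc23` §4, GO res-L1-w42-plan-1 RULING v3.14-34 (HL)). VERBATIM re-typing at `MvPowerSeries (Fin (d + 1)) κ` (`t = X 0`)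
of lead-1's `…IsoTailsFormalFrameStep` (p523847, `d = 3`) and of the point-matching §2 of `…IsoTailsFormalFrameTower` (p524558) under
the NEW namespace `FormalFrameGen` (same declaration names, so that the `d = 3` consumers — res-D-pv-010's `exists_frameStep`
(`…FormalFrameAssemblyStep`), res-type-001's `…FormalFrameTowerStep` — port by renaming), over file 1 `…IsoTailsArcTranslatedGen`
(`SeriesGen.transChartSubst`). The ring-side input of `stepFrame` for a general kernel is res-type-071's G2a socket
`EmbeddedStep.exists_maximalIdeal_presentation_ideal(_tower)` (p536003: `R′ = Localization.AtPrime 𝔑`, `𝔑` maximal in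
`blowupAlgebra (maximalIdeal R) t`). NOT re-typed: the hypersurface glue `FormalFrame.mem_pow_of_frameTower` (ROUTE H only).

A FORMAL FRAME on a local ring `(R, 𝔪)` is a LOCAL homomorphism `ψ : R → κ⟦t, y_1, …, y_d⟧` with `ψ(t) = t`; one free-rational step
replaces `R` by a localisation `R′` of `R[𝔪/t]` at a `κ`-rational point of the `t`-chart. §§1–3: `substHom c` (`y_i ↦ t·y_i + c_i·t`),
`stepHom`, **`stepLift c hψt : R[𝔪/t] →+* κ⟦t, y⟧`** (tree `blowupAlgebra.lift`, Görtz–Wedhorn (13.19)) with `stepLift_algebraMap/_t/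
_div_mul/_div_sub_mem_span/_newCoord_sub_mem_span`, `subst_transChartSubst_eq_of_strictTransform(')` (hypersurface reading, kept),
`stepPrime c hψt = ψ′₀⁻¹(𝔪)`, **`stepFrame c hψt R′`** with `stepFrame_algebraMap(_algebraMap)` (THE COMMUTATION `ψ′ ∘ (R → R′) = φ_c ∘ ψ`),
`stepFrame_t`, **`isLocalHom_stepFrame`**; §4: `newCoord_mem_stepPrime`, `sub_C_constantCoeff_mem`, **`stepPrime_isMaximal`**,
**`span_le_stepPrime`**, `eq_stepPrime_of_isMaximal_of_le` (the frame follows any prescribed free-rational step).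

NOT a statement of H. Hironaka's manuscript [Hironaka2017] nor of [CossartJannsenSaito2020] / [CossartPiltant2009]; AI-written, weaker
than expert review. References: U. Görtz, T. Wedhorn, *Algebraic Geometry I* (2nd ed. 2020), (13.19) p. 415 [GortzWedhorn2020];
V. Cossart, O. Piltant, J. Algebra 321 (2009) ch. 3 I.9 (formal arc) [CossartPiltant2009].
-/
noncomputable section

set_option linter.dupNamespace false -- mandated namespace of this single-conjunct summit
open MvPowerSeries IsLocalRing
open Literature.AlgebraicGeometry.Resolution

namespace Summit.ResolutionOfSingularities.ResolutionOfSingularities.Cruxes.SigmaMaxModifications.IdeasL1C5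

universe u
namespace FormalFrameGen

variable {d : ℕ} {κ : Type u} [Field κ]

/-! ### §1. The local ring `κ⟦t, y_1, …, y_d⟧` -/

/-- Membership in the maximal ideal of `κ⟦t, y⟧` is vanishing of the constant coefficient. [folklore] -/
theorem mem_maximalIdeal_iff (f : (MvPowerSeries (Fin (d + 1)) κ)) : f ∈ maximalIdeal (MvPowerSeries (Fin (d + 1)) κ) ↔ constantCoeff f = 0 := by
  rw [IsLocalRing.mem_maximalIdeal, mem_nonunits_iff, MvPowerSeries.isUnit_iff_constantCoeff, isUnit_iff_ne_zero,
    not_not]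

/-- The translated chart substitution maps the maximal ideal into `(t)`: every variable goes to a multiple of `t`. [folklore] -/
theorem X_zero_dvd_subst_transChartSubst (c : Fin (d + 1) → κ) {f : (MvPowerSeries (Fin (d + 1)) κ)} (hf : f ∈ maximalIdeal (MvPowerSeries (Fin (d + 1)) κ)) :
    (X 0 : (MvPowerSeries (Fin (d + 1)) κ)) ∣ subst (SeriesGen.transChartSubst c) f := by
  rw [mem_maximalIdeal_iff] at hf
  rw [X_dvd_iff]
  intro e he
  rw [coeff_subst (SeriesGen.hasSubst_transChartSubst c)]
  apply finsum_eq_zero_of_forall_eq_zero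
  intro n
  by_cases hd : n = 0
  · subst hd
    rw [MvPowerSeries.coeff_zero_eq_constantCoeff_apply, hf, zero_smul]
  · -- `∏ (a s)^{n s}` is divisible by `t`
    obtain ⟨s, hs⟩ : ∃ s, n s ≠ 0 := by
      by_contra! h; exact hd (Finsupp.ext h)
    have hdvd : (X 0 : (MvPowerSeries (Fin (d + 1)) κ)) ∣ n.prod fun s e => SeriesGen.transChartSubst c s ^ e := by
      have h1 : (X 0 : (MvPowerSeries (Fin (d + 1)) κ)) ∣ SeriesGen.transChartSubst c s := by
        by_cases hs0 : s = 0
        · subst hs0; rw [SeriesGen.transChartSubst_apply_zero]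
        · rw [SeriesGen.transChartSubst_apply_of_ne _ hs0]
          exact ⟨X s + C (c s), by ring⟩
      have h2 : SeriesGen.transChartSubst c s ∣ SeriesGen.transChartSubst c s ^ n s := dvd_pow_self _ hs
      exact (h1.trans h2).trans (Finset.dvd_prod_of_mem _ (Finsupp.mem_support_iff.mpr hs))
    have hz : coeff e (n.prod fun s e => SeriesGen.transChartSubst c s ^ e) = 0 := (X_dvd_iff.mp hdvd) e he
    rw [hz, smul_zero]

/-- Hence it maps the maximal ideal into the ideal `(t)`. [folklore] -/
theorem subst_transChartSubst_mem_span_X_zero (c : Fin (d + 1) → κ) {f : (MvPowerSeries (Fin (d + 1)) κ)} (hf : f ∈ maximalIdeal (MvPowerSeries (Fin (d + 1)) κ)) :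
    subst (SeriesGen.transChartSubst c) f ∈ Ideal.span {(X 0 : (MvPowerSeries (Fin (d + 1)) κ))} := by
  rw [Ideal.mem_span_singleton]
  exact X_zero_dvd_subst_transChartSubst c hf

/-- `t` is a non-zero-divisor of `κ⟦t, y⟧`. [folklore] -/
theorem X_zero_mem_nonZeroDivisors : (X 0 : (MvPowerSeries (Fin (d + 1)) κ)) ∈ nonZeroDivisors (MvPowerSeries (Fin (d + 1)) κ) :=
  MvPowerSeries.X_mem_nonzeroDivisors

/-! ### §2. One free-rational step: the lift to the affine blowup algebra -/

/-- The translated chart substitution as a ring endomorphism of `κ⟦t, y⟧`. [folklore] -/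
abbrev substHom (c : Fin (d + 1) → κ) : MvPowerSeries (Fin (d + 1)) κ →+* MvPowerSeries (Fin (d + 1)) κ :=
  (substAlgHom (R := κ) (SeriesGen.hasSubst_transChartSubst c)).toRingHom

/-- Unfolding `substHom`. [folklore] -/
theorem substHom_apply (c : Fin (d + 1) → κ) (f : MvPowerSeries (Fin (d + 1)) κ) :
    substHom c f = subst (SeriesGen.transChartSubst c) f := by
  simp [substHom]

/-- `t ↦ t`. [folklore] -/
theorem substHom_X_zero (c : Fin (d + 1) → κ) : substHom c (X 0) = X 0 := by
  rw [substHom_apply, subst_X (SeriesGen.hasSubst_transChartSubst c), SeriesGen.transChartSubst_apply_zero]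

/-- `y_i ↦ t y_i + c_i t`. [folklore] -/
theorem substHom_X_of_ne (c : Fin (d + 1) → κ) {i : Fin (d + 1)} (hi : i ≠ 0) : substHom c (X i) = X 0 * X i + C (c i) * X 0 := by
  rw [substHom_apply, subst_X (SeriesGen.hasSubst_transChartSubst c), SeriesGen.transChartSubst_apply_of_ne _ hi]

/-- Constants are fixed. [folklore] -/
theorem substHom_C (c : Fin (d + 1) → κ) (a : κ) : substHom c (C a) = C a := by
  rw [substHom_apply, subst_C]

/-- `φ_c(𝔪) ⊆ (t)`. [folklore] -/
theorem substHom_mem_span_X_zero (c : Fin (d + 1) → κ) {f : MvPowerSeries (Fin (d + 1)) κ}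
    (hf : f ∈ maximalIdeal (MvPowerSeries (Fin (d + 1)) κ)) : substHom c f ∈ Ideal.span {(X 0 : MvPowerSeries (Fin (d + 1)) κ)} := by
  rw [substHom_apply]; exact subst_transChartSubst_mem_span_X_zero c hf

/-- `φ_c(𝔪²) ⊆ (t²)`. [folklore] -/
theorem substHom_mem_span_X_zero_sq (c : Fin (d + 1) → κ) {q : MvPowerSeries (Fin (d + 1)) κ}
    (hq : q ∈ maximalIdeal (MvPowerSeries (Fin (d + 1)) κ) ^ 2) :
    substHom c q ∈ Ideal.span {(X 0 : MvPowerSeries (Fin (d + 1)) κ) ^ 2} := by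
  have hmap : (maximalIdeal (MvPowerSeries (Fin (d + 1)) κ) ^ 2).map (substHom c) ≤ Ideal.span {(X 0) ^ 2} := by
    rw [Ideal.map_pow, ← Ideal.span_singleton_pow]
    apply Ideal.pow_right_mono
    rw [Ideal.map_le_iff_le_comap]
    intro f hf
    exact substHom_mem_span_X_zero c hf
  exact hmap (Ideal.mem_map_of_mem _ hq)

/-- `φ_c` fixes constants modulo `(t)`: `ψ x ≡ a (mod 𝔪) ⇒ φ_c(x) ≡ a (mod t)`. [folklore] -/
theorem substHom_sub_C_mem_span (c : Fin (d + 1) → κ) {f : MvPowerSeries (Fin (d + 1)) κ} {a : κ}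
    (hf : f - C a ∈ maximalIdeal (MvPowerSeries (Fin (d + 1)) κ)) :
    substHom c f - C a ∈ Ideal.span {(X 0 : MvPowerSeries (Fin (d + 1)) κ)} := by
  have h := substHom_mem_span_X_zero c hf
  rwa [map_sub, substHom_C] at h

/-- Cancelling one `t`: `z · t ∈ (t²) ⇒ z ∈ (t)`. [folklore] -/
theorem mem_span_X_zero_of_mul_mem_sq {z : MvPowerSeries (Fin (d + 1)) κ}
    (hz : z * X 0 ∈ Ideal.span {(X 0 : MvPowerSeries (Fin (d + 1)) κ) ^ 2}) : z ∈ Ideal.span {(X 0 : MvPowerSeries (Fin (d + 1)) κ)} := by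
  rw [Ideal.mem_span_singleton] at hz ⊢
  obtain ⟨w, hw⟩ := hz
  refine ⟨w, ?_⟩
  have h : z * X 0 = (X 0 * w) * X 0 := by rw [hw]; ring
  exact mul_right_cancel₀ (nonZeroDivisors.ne_zero X_zero_mem_nonZeroDivisors) h

/-- From `(mod t)` to the frame invariant `(mod 𝔪²)` with a slope: `z ∈ (t) ⇒ ∃ λ′, z − λ′ t ∈ 𝔪²`. [folklore] -/
theorem exists_sub_C_mul_X_zero_mem_sq {z : MvPowerSeries (Fin (d + 1)) κ} (hz : z ∈ Ideal.span {(X 0 : MvPowerSeries (Fin (d + 1)) κ)}) :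
    ∃ lam' : κ, z - C lam' * X 0 ∈ maximalIdeal (MvPowerSeries (Fin (d + 1)) κ) ^ 2 := by
  rw [Ideal.mem_span_singleton] at hz
  obtain ⟨u, rfl⟩ := hz
  refine ⟨constantCoeff u, ?_⟩
  have hu : u - C (constantCoeff u) ∈ maximalIdeal (MvPowerSeries (Fin (d + 1)) κ) := by
    rw [mem_maximalIdeal_iff, map_sub, constantCoeff_C, sub_self]
  have hX : (X 0 : MvPowerSeries (Fin (d + 1)) κ) ∈ maximalIdeal (MvPowerSeries (Fin (d + 1)) κ) := by
    rw [mem_maximalIdeal_iff, constantCoeff_X]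
  have : X 0 * u - C (constantCoeff u) * X 0 = X 0 * (u - C (constantCoeff u)) := by ring
  rw [this, pow_two]
  exact Ideal.mul_mem_mul hX hu

section Step

variable {R : Type u} [CommRing R] [IsLocalRing R] (t : R) (ψ : R →+* (MvPowerSeries (Fin (d + 1)) κ)) [IsLocalHom ψ]
  (c : Fin (d + 1) → κ)

/-- The translated composite `φ_c = (y ↦ t·y + c·t) ∘ ψ : R → κ⟦t, y⟧`. [folklore] -/
abbrev stepHom : R →+* (MvPowerSeries (Fin (d + 1)) κ) :=
  (substHom c).comp ψ

omit [IsLocalRing R] [IsLocalHom ψ] in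
/-- Unfolding `stepHom`. [folklore] -/
theorem stepHom_apply (r : R) : stepHom ψ c r = substHom c (ψ r) := rfl

variable (hψt : ψ t = X 0)
include hψt

omit [IsLocalRing R] [IsLocalHom ψ] in
/-- `φ_c(t) = t`. [folklore] -/
theorem stepHom_t : stepHom ψ c t = X 0 := by
  rw [stepHom_apply, hψt, substHom_X_zero]

omit [IsLocalRing R] [IsLocalHom ψ] in
/-- `φ_c(t)` is a non-zero-divisor. [folklore] -/
theorem stepHom_t_mem_nonZeroDivisors : stepHom ψ c t ∈ nonZeroDivisors (MvPowerSeries (Fin (d + 1)) κ) := by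
  rw [stepHom_t t ψ c hψt]; exact X_zero_mem_nonZeroDivisors

omit hψt in
/-- `φ_c(𝔪_R) ⊆ (t)`: `ψ` is local and the substitution sends `𝔪` into `(t)`. [folklore] -/
theorem map_maximalIdeal_stepHom_le :
    (maximalIdeal R).map (stepHom ψ c) ≤ Ideal.span {(X 0 : (MvPowerSeries (Fin (d + 1)) κ))} := by
  rw [Ideal.map_le_iff_le_comap]
  intro r hr
  rw [Ideal.mem_comap, stepHom_apply]
  exact substHom_mem_span_X_zero c (map_nonunit ψ r hr)

/-- **THE LIFT `ψ′₀ : R[𝔪/t] → κ⟦t, y⟧`** of `φ_c` to the affine blowup algebra (tree `blowupAlgebra.lift`, GW (13.19)). [folklore] -/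
def stepLift : blowupAlgebra (maximalIdeal R) t →+* (MvPowerSeries (Fin (d + 1)) κ) :=
  blowupAlgebra.lift (maximalIdeal R) (a := t) (φ := stepHom ψ c) (stepHom_t_mem_nonZeroDivisors t ψ c hψt)
    (by rw [stepHom_t t ψ c hψt]; exact map_maximalIdeal_stepHom_le ψ c)

variable {t ψ}

/-- The lift extends `φ_c`: on `R` it is `(y ↦ t y + c t) ∘ ψ`. [folklore] -/
theorem stepLift_algebraMap (r : R) :
    stepLift t ψ c hψt (algebraMap R _ r) = substHom c (ψ r) := by
  rw [stepLift, blowupAlgebra.lift_algebraMap, stepHom_apply]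

/-- `ψ′₀(t) = t`. [folklore] -/
theorem stepLift_t : stepLift t ψ c hψt (algebraMap R _ t) = X 0 := by
  rw [stepLift_algebraMap, hψt, substHom_X_zero]

/-- **THE STRICT-TRANSFORM EQUATION in the frame**: if `h = t^m · h′` in `R[𝔪/t]` then
`(ψ h)(t, t y + c t) = t^m · ψ′₀(h′)` — exactly the step hypothesis of `SeriesGen.mem_pow_of_translatedStrictTransforms`. [folklore] -/
theorem subst_transChartSubst_eq_of_strictTransform {h : R} {m : ℕ} {h' : blowupAlgebra (maximalIdeal R) t}
    (hh' : algebraMap R _ h = algebraMap R _ t ^ m * h') :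
    subst (SeriesGen.transChartSubst c) (ψ h) = X 0 ^ m * stepLift t ψ c hψt h' := by
  rw [← substHom_apply, ← stepLift_algebraMap c hψt, hh', map_mul, map_pow, stepLift_t]

/-- `ψ′₀(x/t) · t = φ_c(x)` for `x ∈ 𝔪_R`. [folklore] -/
theorem stepLift_div_mul {x : R} (hx : x ∈ maximalIdeal R) :
    stepLift t ψ c hψt ⟨_, div_mem_blowupAlgebra (maximalIdeal R) t hx⟩ * X 0 = substHom c (ψ x) := by
  have h := blowupAlgebra.lift_div_mul (maximalIdeal R) (stepHom_t_mem_nonZeroDivisors t ψ c hψt)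
    (by rw [stepHom_t t ψ c hψt]; exact map_maximalIdeal_stepHom_le ψ c) hx
  calc stepLift t ψ c hψt ⟨_, div_mem_blowupAlgebra (maximalIdeal R) t hx⟩ * X 0
      = stepLift t ψ c hψt ⟨_, div_mem_blowupAlgebra (maximalIdeal R) t hx⟩ * stepHom ψ c t := by
        rw [stepHom_t t ψ c hψt]
    _ = stepHom ψ c x := h
    _ = substHom c (ψ x) := rfl

/-- **THE NEW FRAME COORDINATE, first form**: if `ψ r ≡ y_i + λ t (mod 𝔪²)` then `ψ′₀(r/t) ≡ y_i + (c_i + λ) (mod t)`. [folklore] -/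
theorem stepLift_div_sub_mem_span {r : R} (hr : r ∈ maximalIdeal R) {i : Fin (d + 1)} (hi : i ≠ 0) {lam : κ}
    (hψr : ψ r - X i - C lam * X 0 ∈ maximalIdeal (MvPowerSeries (Fin (d + 1)) κ) ^ 2) :
    stepLift t ψ c hψt ⟨_, div_mem_blowupAlgebra (maximalIdeal R) t hr⟩ - X i - C (c i + lam) ∈
      Ideal.span {(X 0 : MvPowerSeries (Fin (d + 1)) κ)} := by
  apply mem_span_X_zero_of_mul_mem_sq
  have hq := substHom_mem_span_X_zero_sq c hψr
  rw [map_sub, map_sub, map_mul, substHom_C, substHom_X_of_ne c hi, substHom_X_zero, ← stepLift_div_mul c hψt hr] at hq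
  convert hq using 1
  simp only [map_add]
  ring

/-- **THE NEW FRAME COORDINATE**: with `c̃ ∈ R` lifting `c_i + λ`, `r′ = r/t − c̃` satisfies `ψ′₀(r′) ≡ y_i (mod t)`. [folklore] -/
theorem stepLift_newCoord_sub_mem_span {r : R} (hr : r ∈ maximalIdeal R) {i : Fin (d + 1)} (hi : i ≠ 0) {lam : κ}
    (hψr : ψ r - X i - C lam * X 0 ∈ maximalIdeal (MvPowerSeries (Fin (d + 1)) κ) ^ 2) {ct : R}
    (hct : ψ ct - C (c i + lam) ∈ maximalIdeal (MvPowerSeries (Fin (d + 1)) κ)) :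
    stepLift t ψ c hψt (⟨_, div_mem_blowupAlgebra (maximalIdeal R) t hr⟩ - algebraMap R _ ct) - X i ∈
      Ideal.span {(X 0 : MvPowerSeries (Fin (d + 1)) κ)} := by
  have h1 := stepLift_div_sub_mem_span c hψt hr hi hψr
  have h2 := substHom_sub_C_mem_span c hct
  rw [map_sub, stepLift_algebraMap]
  have : stepLift t ψ c hψt ⟨_, div_mem_blowupAlgebra (maximalIdeal R) t hr⟩ - substHom c (ψ ct) - X i =
      (stepLift t ψ c hψt ⟨_, div_mem_blowupAlgebra (maximalIdeal R) t hr⟩ - X i - C (c i + lam)) -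
        (substHom c (ψ ct) - C (c i + lam)) := by ring
  rw [this]
  exact Ideal.sub_mem _ h1 h2

/-! ### §3. Localising at the point seen by the frame -/

/-- **The point of the chart seen by the frame**: `𝔔_c = ψ′₀⁻¹(𝔪)`, a prime of `R[𝔪/t]` containing `t`. [folklore] -/
abbrev stepPrime : Ideal (blowupAlgebra (maximalIdeal R) t) :=
  Ideal.comap (stepLift t ψ c hψt) (maximalIdeal (MvPowerSeries (Fin (d + 1)) κ))

/-- `t ∈ 𝔔_c`. [folklore] -/
theorem algebraMap_t_mem_stepPrime : algebraMap R _ t ∈ stepPrime c hψt := by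
  rw [stepPrime, Ideal.mem_comap, stepLift_t, mem_maximalIdeal_iff, constantCoeff_X]

/-- Off `𝔔_c` the lift takes unit values. [folklore] -/
theorem isUnit_stepLift_of_not_mem {b : blowupAlgebra (maximalIdeal R) t} (hb : b ∉ stepPrime c hψt) :
    IsUnit (stepLift t ψ c hψt b) := by
  by_contra hu
  exact hb ((IsLocalRing.mem_maximalIdeal _).mpr hu)

variable (R' : Type u) [CommRing R'] [Algebra (blowupAlgebra (maximalIdeal R) t) R']
  [IsLocalization.AtPrime R' (stepPrime c hψt)]

/-- **THE NEW FRAME `ψ′ : R[𝔪/t]_{𝔔_c} → κ⟦t, y⟧`** (localisation of the lift). [folklore] -/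
def stepFrame : R' →+* MvPowerSeries (Fin (d + 1)) κ :=
  IsLocalization.lift (M := (stepPrime c hψt).primeCompl) (g := stepLift t ψ c hψt)
    fun y => isUnit_stepLift_of_not_mem c hψt y.2

/-- `ψ′` extends `ψ′₀`. [folklore] -/
theorem stepFrame_algebraMap (b : blowupAlgebra (maximalIdeal R) t) :
    stepFrame c hψt R' (algebraMap _ R' b) = stepLift t ψ c hψt b :=
  IsLocalization.lift_eq _ _

/-- **THE COMMUTATION**: `ψ′ ∘ (R → R′) = (y ↦ t y + c t) ∘ ψ`. [folklore] -/
theorem stepFrame_algebraMap_algebraMap [Algebra R R'] [IsScalarTower R (blowupAlgebra (maximalIdeal R) t) R'] (r : R) :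
    stepFrame c hψt R' (algebraMap R R' r) = subst (SeriesGen.transChartSubst c) (ψ r) := by
  rw [IsScalarTower.algebraMap_apply R (blowupAlgebra (maximalIdeal R) t) R', stepFrame_algebraMap,
    stepLift_algebraMap, substHom_apply]

/-- `ψ′(t) = t`. [folklore] -/
theorem stepFrame_t [Algebra R R'] [IsScalarTower R (blowupAlgebra (maximalIdeal R) t) R'] :
    stepFrame c hψt R' (algebraMap R R' t) = X 0 := by
  rw [stepFrame_algebraMap_algebraMap, hψt, subst_X (SeriesGen.hasSubst_transChartSubst c), SeriesGen.transChartSubst_apply_zero]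

/-- **`ψ′` is a LOCAL homomorphism** (so the construction iterates). [folklore] -/
theorem isLocalHom_stepFrame : IsLocalHom (stepFrame c hψt R') := by
  constructor
  intro z hz
  obtain ⟨⟨b, s⟩, rfl⟩ := IsLocalization.mk'_surjective (stepPrime c hψt).primeCompl z
  rw [IsLocalization.AtPrime.isUnit_mk'_iff]
  intro hb
  have hspec := (IsLocalization.lift_mk'_spec (M := (stepPrime c hψt).primeCompl)
    (g := stepLift t ψ c hψt) (fun y => isUnit_stepLift_of_not_mem c hψt y.2) b
    (stepFrame c hψt R' (IsLocalization.mk' R' b s)) s).mp rfl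
  have hu : IsUnit (stepLift t ψ c hψt b) := by
    rw [hspec]; exact (isUnit_stepLift_of_not_mem c hψt s.2).mul hz
  exact ((IsLocalRing.mem_maximalIdeal _).mp (Ideal.mem_comap.mp hb)) hu

/-- **The strict-transform equation read in `R′`**. [folklore] -/
theorem subst_transChartSubst_eq_of_strictTransform' [Algebra R R'] [IsScalarTower R (blowupAlgebra (maximalIdeal R) t) R']
    {h : R} {m : ℕ} {h' : blowupAlgebra (maximalIdeal R) t} (hh' : algebraMap R _ h = algebraMap R _ t ^ m * h') :
    subst (SeriesGen.transChartSubst c) (ψ h) = X 0 ^ m * stepFrame c hψt R' (algebraMap _ R' h') := by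
  rw [stepFrame_algebraMap, subst_transChartSubst_eq_of_strictTransform c hψt hh']

end Step

/-! ### §4. Point matching: the prime seen by the frame is the prescribed `κ`-point of the `t`-chart -/

section PointMatching

variable {R : Type u} [CommRing R] [IsLocalRing R] {t : R} {ψ : R →+* MvPowerSeries (Fin (d + 1)) κ} [IsLocalHom ψ]
  (c : Fin (d + 1) → κ) (hψt : ψ t = X 0)

/-- A point `r/t − ã` of the `t`-chart with `ψ r ≡ y_i + λ t (mod 𝔪²)` lies in `𝔔_c` as soon as `c_i + λ` is the residue of `ã`
(`stepLift_newCoord_sub_mem_span`). [folklore] -/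
theorem newCoord_mem_stepPrime {r : R} (hr : r ∈ maximalIdeal R) {i : Fin (d + 1)} (hi : i ≠ 0) {lam : κ}
    (hψr : ψ r - X i - C lam * X 0 ∈ maximalIdeal (MvPowerSeries (Fin (d + 1)) κ) ^ 2) {ct : R}
    (hct : ψ ct - C (c i + lam) ∈ maximalIdeal (MvPowerSeries (Fin (d + 1)) κ)) :
    (⟨_, div_mem_blowupAlgebra (maximalIdeal R) t hr⟩ - algebraMap R _ ct : blowupAlgebra (maximalIdeal R) t) ∈
      stepPrime c hψt := by
  rw [Ideal.mem_comap]
  have h := stepLift_newCoord_sub_mem_span c hψt hr hi hψr hct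
  have hX0 : Ideal.span {(X 0 : MvPowerSeries (Fin (d + 1)) κ)} ≤ maximalIdeal _ := by
    rw [Ideal.span_le, Set.singleton_subset_iff]; exact (mem_maximalIdeal_iff _).mpr (constantCoeff_X _)
  have hXi : (X i : MvPowerSeries (Fin (d + 1)) κ) ∈ maximalIdeal _ := (mem_maximalIdeal_iff _).mpr (constantCoeff_X _)
  have := Ideal.add_mem _ (hX0 h) hXi
  simpa using this

/-- The residue of `ã` determines the matching constant: `c_i := res(ψ ã) − λ` satisfies the hypothesis of `newCoord_mem_stepPrime`.
[folklore] -/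
theorem sub_C_constantCoeff_mem (f : MvPowerSeries (Fin (d + 1)) κ) : f - C (constantCoeff f) ∈ maximalIdeal (MvPowerSeries (Fin (d + 1)) κ) := by
  rw [mem_maximalIdeal_iff, map_sub, constantCoeff_C, sub_self]

/-- **𝔔_c IS MAXIMAL** (its residue ring embeds in `κ` and receives `R/𝔪 ↠ κ`), for a frame with surjective residue map. [folklore] -/
theorem stepPrime_isMaximal (hsurj : ∀ a : κ, ∃ x : R, ψ x - C a ∈ maximalIdeal (MvPowerSeries (Fin (d + 1)) κ)) :
    (stepPrime c hψt).IsMaximal := by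
  -- the composite `R[𝔪/t] → κ⟦t,y⟧ → κ` has kernel `𝔔_c` and is onto
  let ρ : blowupAlgebra (maximalIdeal R) t →+* κ := (constantCoeff).comp (stepLift t ψ c hψt)
  have hker : RingHom.ker ρ = stepPrime c hψt := by
    ext b
    rw [RingHom.mem_ker, Ideal.mem_comap, mem_maximalIdeal_iff]
    rfl
  have hsurjρ : Function.Surjective ρ := by
    intro a
    obtain ⟨x, hx⟩ := hsurj a
    refine ⟨algebraMap R _ x, ?_⟩
    change constantCoeff (stepLift t ψ c hψt (algebraMap R _ x)) = a
    rw [stepLift_algebraMap, substHom_apply]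
    have h1 : constantCoeff (subst (SeriesGen.transChartSubst c) (ψ x - C a)) = 0 :=
      constantCoeff_subst_eq_zero (SeriesGen.hasSubst_transChartSubst c)
        (fun i => by
          by_cases hi : i = 0
          · subst hi; rw [SeriesGen.transChartSubst_apply_zero, constantCoeff_X]
          · rw [SeriesGen.transChartSubst_apply_of_ne _ hi]; simp)
        ((mem_maximalIdeal_iff _).mp hx)
    rw [subst_sub (SeriesGen.hasSubst_transChartSubst c), subst_C, map_sub, constantCoeff_C, sub_eq_zero] at h1
    exact h1
  rw [← hker]
  exact RingHom.ker_isMaximal_of_surjective ρ hsurjρ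

/-- **POINT MATCHING.** If `𝔪_R = (t, r₁, r₂, r₃)`, then for ANY elements `ã_i ∈ R` the `κ`-point `𝔑 = (t, r_i/t − ã_i)` of the `t`-chart
IS the prime `𝔔_c` seen by the frame for the constants `c_i := res(ψ ã_i) − λ_i` — so the frame follows any prescribed free-rational step
(res-type-071's H5 presents the tower's point in exactly this form). [folklore] -/
theorem span_le_stepPrime {r : Fin (d + 1) → R} (hr : ∀ i, i ≠ 0 → r i ∈ maximalIdeal R) {lam : Fin (d + 1) → κ}
    (hψr : ∀ i, i ≠ 0 → ψ (r i) - X i - C (lam i) * X 0 ∈ maximalIdeal (MvPowerSeries (Fin (d + 1)) κ) ^ 2) (at_ : Fin (d + 1) → R)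
    (hc : ∀ i, i ≠ 0 → c i = constantCoeff (ψ (at_ i)) - lam i) :
    ∀ i (hi : i ≠ 0), (⟨_, div_mem_blowupAlgebra (maximalIdeal R) t (hr i hi)⟩ - algebraMap R _ (at_ i) :
      blowupAlgebra (maximalIdeal R) t) ∈ stepPrime c hψt := by
  intro i hi
  refine newCoord_mem_stepPrime c hψt (hr i hi) hi (hψr i hi) ?_
  rw [hc i hi, sub_add_cancel]
  exact sub_C_constantCoeff_mem _

/-- Consequently any MAXIMAL ideal of `R[𝔪/t]` contained in `𝔔_c` — e.g. the point `(t, r_i/t − ã_i)` presented as a maximal ideal —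
IS `𝔔_c`, and its localisation carries the frame `stepFrame c hψt`. [folklore] -/
theorem eq_stepPrime_of_isMaximal_of_le {N : Ideal (blowupAlgebra (maximalIdeal R) t)} (hN : N.IsMaximal)
    (hle : N ≤ stepPrime c hψt) : N = stepPrime c hψt :=
  hN.eq_of_le (Ideal.IsPrime.ne_top inferInstance) hle

end PointMatching
end FormalFrameGen

end Summit.ResolutionOfSingularities.ResolutionOfSingularities.Cruxes.SigmaMaxModifications.IdeasL1C5

end
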